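import Summits.QuantumFields.YangMills.Theorems.BalabanUVNodesN22WindowedDecayOutputLevel
import Summits.QuantumFields.YangMills.Theorems.BalabanUVNodesN18KernelLettersJunctionsUniform

/-!
# BalabanUVNodes ∕ node N22 = NE9 (decay side) — THE UNIFORM KERNEL DECAY OF RECORD `DecayBound ((objectsOfRecord₁₃ F N θ ℓ).EA 0) (Window θ.γ) E₁ δ₁` FROM THE OUTPUT-LEVEL MARGIN
# DATUM: the (1.18)-type bound at real couplings is INSIDE J34∕J39's `hL`; W1-19c's UNIFORM windowed (5.10) letter for the localized sum (J36's road, one constant for all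
# histories); W1-20's law; dag-n18-w4's passage to node U3's decay slot

Cell `pub-ymgap`, HUMAN RULING D-0062 (Track A), R134 seat `pub-ymgap-dag-n22-c` (strategy s1), generation 14, module J41.  THEOREMS ONLY (no `def`, no `sorry`, standard axioms);
`--kind proof --supports stmt-QuantumFields-20544 --as helper` (K3⁷ `SpineGivenEndpointR13SepCoPH`, skeleton v5 941dddb108cb), COUNT-NEUTRAL.  Imports J36
`…Theorems.BalabanUVNodesN22WindowedDecayOutputLevel` (`abs_polWindow_localizedSum_le_soft_of_outputBound`, `outputValueSummand_le_softMajorant`; dag-n22-w2's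
`eventually_le_of_softSum_domSys`) and dag-n18-w4's `…Theorems.BalabanUVNodesN18KernelLettersJunctionsUniform` (`decayBound_EA_of_windowedDecayUniform`; W1-19c `Node00.U3KernelLetters2`).
Nothing re-declared.

WHY.  Module J38's kernel-fading road (and J40, its junction at the record) displays, next to node N18's kernel step rate and the second-difference letter, the UNIFORM kernel decay
`DecayBound ((objectsOfRecord₁₃ …).EA 0) (Window θ.γ) E₀ κ` ([I] (1.18)∕(5.10), uniform in the history — the base of the oscillation peeling at the youngest coupling).  That letter is NOT
an independent input of the output-level road: the margin datum `hL` (a holomorphic extension in one coupling about `]0, γ]` bounded by `B·e^{−κ_E d}`) CONTAINS the term bound at real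
couplings (§1 `outputBound_of_coordHolo`), J36's soft machinery turns it into W1-19c's UNIFORM windowed letter `WindowedDecayUniform F (localizedSum F S emb) ρ bV (Window γ) E₁ δ₁` with
ONE constant `E₁ = (16·B·B₃²∕r²)·e^{12Mδ₁}K₀(64,8)K₁(4,δ₀∕2)` (§1 `windowedDecayUniform_localizedSum_of_outputBound`; J36's `windowedDecay_localizedSum_of_outputBound` is the per-sequence
edition), and under W1-20's law + (1.21) existence dag-n18-w4's `decayBound_EA_of_windowedDecayUniform` gives node U3's decay slot AT THE RECORD (§2 ★
`decayBound_objectsOfRecord₁₃_of_outputCoordHolo`).  J40 §2′ consumes it.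

HONEST FRAMING (binding).  Count-neutral kernel bookkeeping over DISPLAYED hypotheses (the margin datum ∕ readings ∕ tails: N09 ∕ N10 ∕ NODE A; the law: def-W1 ∕ NODE A; (1.21):
dag-n22-w3's road); NO estimate of Bałaban's is proved or asserted; nothing of the record is constructed or claimed to meet them; N22 is NOT discharged (typed 28∕28 · discharged 5∕27
UNCHANGED); K3⁷ OPEN and NOT claimed; no count claim; one finite 𝕋⁴ programme at fixed ε — R4 closes the CONDITIONAL rung `BalabanLadder.UV` only; NOTHING about the continuum limit, ℝ⁴,
infinite volume, OS axioms, a mass gap or the Clay problem is proved or claimed.  References (TYPES only): [I] = Bałaban, CMP 109 (1987) (1.7) p. 261, (1.18) p. 263, (1.20)–(1.21)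
p. 264, §2 p. 266, p. 282 (site-weight tails: the sentence after (4.4)), (4.35)–(4.37) pp. 290–291, (5.10) p. 293; [II] = CMP 116 (1988) (2.13)–(2.14) pp. 14–15.
-/

noncomputable section

open Filter Topology Set Metric
open scoped BigOperators

namespace YMDAG.N22.UniformDecay

open Literature.MathematicalPhysics.QuantumFieldTheory.Balaban1983to89
open Literature.MathematicalPhysics.QuantumFieldTheory.Balaban1983to89.T4Continuum (T4Family)
open Literature.MathematicalPhysics.QuantumFieldTheory.Balaban1983to89.T4OutputRate (Window DecayBound)
open Literature.MathematicalPhysics.QuantumFieldTheory.Balaban1983to89.TreeLengthTorus (TPt torusTreeLen torusTreeLen_nonneg)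
open Literature.MathematicalPhysics.QuantumFieldTheory.Balaban1983to89.B12TreeDecay (K₀ kappa₀ K₀_pos)
open Literature.MathematicalPhysics.QuantumFieldTheory.Balaban1983to89.B12Decay510 (delta1)
open Literature.MathematicalPhysics.QuantumFieldTheory.Balaban1983to89.B12Decay510Window (K₁)
open Literature.MathematicalPhysics.QuantumFieldTheory.Balaban1983to89.B12Decay510Torus (distCT nearT)
open Literature.MathematicalPhysics.QuantumFieldTheory.Balaban1983to89.B12Sec2to5 (l1)
open Literature.MathematicalPhysics.QuantumFieldTheory.Balaban1983to89.Node00 (polWindow siteOfInt mergedTermFamilyMatT TβOfRecord₁₃ chiβOfRecord₁₃ Stage13Params U3Letters₁₁ MatA)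
open Literature.MathematicalPhysics.QuantumFieldTheory.Balaban1983to89.Node00.Sect2 (domSys domCount CPair)
open Literature.MathematicalPhysics.QuantumFieldTheory.Balaban1983to89.Node00.W1
open Literature.MathematicalPhysics.QuantumFieldTheory.Balaban1983to89.Node00.LocalizedSum17 (localizedSum ReadingMaps Localizes17OfRecord₁₃)
open Literature.MathematicalPhysics.QuantumFieldTheory.Balaban1983to89.Node00.U3OfKernels (histPrefix objectsOfRecord₁₃)
open Literature.MathematicalPhysics.QuantumFieldTheory.Balaban1983to89.Node00.U3KernelLetters (PolLimitsExistOfRecord₁₃)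
open Literature.MathematicalPhysics.QuantumFieldTheory.Balaban1983to89.Node00.U3KernelLetters2 (WindowedDecayUniform WindowedDecayUniformOfRecord₁₃
  windowedDecayUniformOfRecord₁₃_iff_of_localizes)
open YMDAG.N22.OutputLevel (abs_polWindow_localizedSum_le_soft_of_outputBound outputValueSummand_le_softMajorant)
open YMDAG.N22.WindowSoftTwoPoint (eventually_le_of_softSum_domSys)
open YMDAG.N18.KernelLettersJunctions (decayBound_EA_of_windowedDecayUniform)

open scoped Matrix.Norms.L2Operator

/-! ## §1 The output bound inside the margin datum; the UNIFORM windowed (5.10) letter of the localized sum -/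

section Generic

variable (F : T4Family) {𝔄 : Type*} [NormedRing 𝔄] [NormedAlgebra ℝ 𝔄] {V : Type*} [NormedAddCommGroup V] [NormedSpace ℝ V]
  {ι' : Type*} [Fintype ι'] {𝔸 : Type*} {M : ℕ}

/-- **THE OUTPUT BOUND AT REAL COUPLINGS IS INSIDE THE MARGIN DATUM**: J34∕J39's `hL` (holomorphic extension in one coupling about `]0, γ]`, bounded by `B·e^{−κ_E d}` on a set containing
the closed discs) gives `‖E^{(k+1)}(X; g; φ)‖ ≤ B·e^{−κ_E d_{k+1}(X)}` at every box prefix `g` — read the extension at `t := g_i`. [folklore] -/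
theorem outputBound_of_coordHolo (S : (K : ℕ) → ClusterTower (F.P K) 𝔸 M) {γ : ℝ} (sp : (K k : ℕ) → (domSys (F.P K) M (k + 1)).Dom → Set (CPair (F.P K) 𝔸))
    {κE B ρ₀ : ℝ} (hρ₀ : 0 < ρ₀)
    (hL : ∀ (K k : ℕ) (i : Fin (k + 1)), ∀ g ∈ box γ k, ∀ (X : (domSys (F.P K) M (k + 1)).Dom), ∀ φ ∈ sp K k X,
      ∃ (Ec : ℂ → ℂ) (O : Set ℂ), DifferentiableOn ℂ Ec O ∧ (∀ t ∈ Ioc (0 : ℝ) γ, closedBall (t : ℂ) ρ₀ ⊆ O) ∧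
        (∀ z ∈ O, ‖Ec z‖ ≤ B * Real.exp (-(κE * (domSys (F.P K) M (k + 1)).dj X))) ∧
        (∀ t ∈ Ioc (0 : ℝ) γ, Ec t = ((S K) k).E (Function.update g i t) φ X))
    (K k : ℕ) (g : Fin (k + 1) → ℝ) (hg : g ∈ box γ k) (X : (domSys (F.P K) M (k + 1)).Dom) (φ : CPair (F.P K) 𝔸) (hφ : φ ∈ sp K k X) :
    ‖((S K) k).E g φ X‖ ≤ B * Real.exp (-(κE * (domSys (F.P K) M (k + 1)).dj X)) := by
  obtain ⟨Ecf, O, -, hball, hbd, heq⟩ := hL K k ⟨0, Nat.succ_pos k⟩ g hg X φ hφ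
  have hg0 : g ⟨0, Nat.succ_pos k⟩ ∈ Ioc (0 : ℝ) γ := hg ⟨0, Nat.succ_pos k⟩
  have h := hbd _ (hball _ hg0 (mem_closedBall_self hρ₀.le))
  rwa [heq _ hg0, Function.update_eq_self] at h

open Classical in
/-- ★ **THE UNIFORM WINDOWED (5.10) DECAY OF THE LOCALIZED SUM FROM AN OUTPUT-LEVEL TERM BOUND** — W1-19c's `WindowedDecayUniform F (localizedSum F S emb) ρ bV (Window γ) E₁ δ₁` with ONE
constant `E₁ = (16·B·B₃²∕r²)·e^{12Mδ₁}K₀(64,8)K₁(4,δ₀∕2)` (J36's `windowedDecay_localizedSum_of_outputBound` is the per-sequence edition; same proof — J36 §1 + dag-n22-w2's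
`eventually_le_of_softSum_domSys`). [folklore] -/
theorem windowedDecayUniform_localizedSum_of_outputBound (m' : ℕ) (M : ℕ) [NeZero M] (hM : M = F.L ^ m')
    (S : (K : ℕ) → ClusterTower (F.P K) 𝔸 M) (emb : ReadingMaps F 𝔄 𝔸) (ρ : V →L[ℝ] 𝔄) (bV : Module.Basis ι' ℝ V)
    {γ : ℝ} (sp : (K k : ℕ) → (domSys (F.P K) M (k + 1)).Dom → Set (CPair (F.P K) 𝔸))
    {κ κE δ₀ B₃ r B : ℝ} (hκ₀ : kappa₀ (4 * 2 ^ 4) (2 * 4) ≤ κ / 2) (hδ₀ : 0 < δ₀) (hB₃ : 0 ≤ B₃) (hr : 0 < r) (hB : 0 ≤ B) (hκE : κ ≤ κE)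
    (hbd : ∀ g ∈ Window γ, ∀ (K k : ℕ) (X : (domSys (F.P K) M (k + 1)).Dom), ∀ φ ∈ sp K k X,
      ‖((S K) k).E (histPrefix g k) φ X‖ ≤ B * Real.exp (-(κE * (domSys (F.P K) M (k + 1)).dj X)))
    (Ec : ℕ → ℕ → Type*) [∀ K k, NormedAddCommGroup (Ec K k)] [∀ K k, NormedSpace ℂ (Ec K k)]
    (ι : (K k : ℕ) → (domSys (F.P K) M (k + 1)).Dom → ((Fin (F.P K).d → Site (F.P K) (k + 1) → V) →L[ℝ] Ec K k))
    (Φ : (K k : ℕ) → (domSys (F.P K) M (k + 1)).Dom → Ec K k → CPair (F.P K) 𝔸)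
    (U : (K k : ℕ) → (domSys (F.P K) M (k + 1)).Dom → Set (Ec K k)) (hU : ∀ K k X, IsOpen (U K k X)) (hrU : ∀ K k X, ball (0 : Ec K k) r ⊆ U K k X)
    (hEhol : ∀ g ∈ Window γ, ∀ (K k : ℕ) (X : (domSys (F.P K) M (k + 1)).Dom),
      DifferentiableOn ℂ (fun z => ((S K) k).E (histPrefix g k) (Φ K k X z) X) (U K k X))
    (hΦemb : ∀ (K k : ℕ) (X : (domSys (F.P K) M (k + 1)).Dom) (Bf : Fin (F.P K).d → Site (F.P K) (k + 1) → V),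
      Φ K k X (ι K k X Bf) = emb K k (fun l t => NormedSpace.exp (ρ (Bf l t))))
    (hΦsp : ∀ (K k : ℕ) (X : (domSys (F.P K) M (k + 1)).Dom), ∀ z ∈ ball (0 : Ec K k) r, Φ K k X z ∈ sp K k X)
    (w : (K k : ℕ) → (domSys (F.P K) M (k + 1)).Dom → Site (F.P K) (k + 1) → ℝ) (hw₀ : ∀ K k X t, 0 ≤ w K k X t)
    (hw : ∀ (K k : ℕ) (X : (domSys (F.P K) M (k + 1)).Dom) (l : Fin (F.P K).d) (t : Site (F.P K) (k + 1)) (c : ι'),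
      ‖ι K k X (Pi.single l (Pi.single t (bV c)))‖ ≤ w K k X t)
    (htail : ∀ (K k : ℕ) (X : (domSys (F.P K) M (k + 1)).Dom) (t : Site (F.P K) (k + 1)),
      let e : Site (F.P K) (k + 1) → TPt 4 (domCount (F.P K) M (k + 1) * M) := fun x i => (ZMod.cast (x i) : ZMod (domCount (F.P K) M (k + 1) * M))
      w K k X t ≤ B₃ * Real.exp (-δ₀ * distCT (domCount (F.P K) M (k + 1)) M (e t) (nearT (M := M) (e t) X))) :
    WindowedDecayUniform F (localizedSum F S emb) ρ bV (Window γ)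
      ((16 * B * B₃ ^ 2 / r ^ 2) * Real.exp (delta1 δ₀ κ ((M : ℝ) * 4) * ((M : ℝ) * 4) * 3) * K₀ (4 * 2 ^ 4) (2 * 4) * K₁ 4 (δ₀ / 2))
      (delta1 δ₀ κ ((M : ℝ) * 4)) := by
  intro g hg k μ ν z
  have hCE : (0 : ℝ) ≤ 16 * B * B₃ ^ 2 / r ^ 2 := by positivity
  have h := eventually_le_of_softSum_domSys F (k + 1) m' M hM
    (fun K => |polWindow F K (k + 1) (localizedSum F S emb k (histPrefix g k) K) ρ bV μ ν z|)
    (fun K X => 16 * (B * Real.exp (-(κE * torusTreeLen X.1))) / r ^ 2 * (w K k X (siteOfInt F K (k + 1) z) * w K k X (siteOfInt F K (k + 1) 0)))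
    hCE zero_le_one hδ₀ hκ₀ z
    (fun K => abs_polWindow_localizedSum_le_soft_of_outputBound F S emb ρ bV k K (sp K k) (hbd g hg K k) (ι K k) (Φ K k) (U K k) (hU K k) hr (hrU K k)
      (hEhol g hg K k) (hΦemb K k) (hΦsp K k) (w K k) (hw₀ K k) (hw K k) μ ν z)
    (fun K X => outputValueSummand_le_softMajorant hB hr hB₃ (hw₀ K k X _) (Real.exp_nonneg _) (Real.exp_nonneg _) (htail K k X _) (htail K k X _) hκE
      (torusTreeLen_nonneg _))
  filter_upwards [h] with K hK
  rw [neg_mul]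
  simpa only [mul_one] using hK

end Generic


/-! ## §2 AT THE RECORD: node U3's decay slot from the margin datum, W1-20's law and (1.21) -/

section Record

variable (F : T4Family) (N : ℕ) [NeZero N] {𝔸 : Type*} {M : ℕ}

open Classical in
/-- ★ **THE UNIFORM KERNEL DECAY OF RECORD FROM THE OUTPUT-LEVEL MARGIN DATUM** (so the decay letter of §2 is NOT a separate input): `hL` with ONE radius + the readings of record + tails +
W1-20's law + (1.21) ⟹ `DecayBound ((objectsOfRecord₁₃ F N θ ℓ).EA 0) (Window θ.γ) E₁ δ₁`, `E₁ = (16·B·B₃²∕r²)·e^{12Mδ₁}K₀K₁` — §1a + W1-19c `windowedDecayUniformOfRecord₁₃_iff_of_localizes` +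
dag-n18-w4's `decayBound_EA_of_windowedDecayUniform` BY NAME. [folklore] -/
theorem decayBound_objectsOfRecord₁₃_of_outputCoordHolo (θ : Stage13Params F N) (ℓ : U3Letters₁₁) (hlim : PolLimitsExistOfRecord₁₃ F N θ)
    (m' : ℕ) (M : ℕ) [NeZero M] (hM : M = F.L ^ m')
    (S : (K : ℕ) → ClusterTower (F.P K) 𝔸 M) (emb : ReadingMaps F (MatA N) 𝔸) (hloc : Localizes17OfRecord₁₃ F N θ S emb)
    (sp : (K k : ℕ) → (domSys (F.P K) M (k + 1)).Dom → Set (CPair (F.P K) 𝔸))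
    {κ κE δ₀ B₃ r B ρ₀ : ℝ} (hρ₀ : 0 < ρ₀)
    (hκ₀ : kappa₀ (4 * 2 ^ 4) (2 * 4) ≤ κ / 2) (hδ₀ : 0 < δ₀) (hB₃ : 0 ≤ B₃) (hr : 0 < r) (hB : 0 ≤ B) (hκE : κ ≤ κE)
    (hL : ∀ (K k : ℕ) (i : Fin (k + 1)), ∀ g ∈ box θ.γ k, ∀ (X : (domSys (F.P K) M (k + 1)).Dom), ∀ φ ∈ sp K k X,
      ∃ (Ec : ℂ → ℂ) (O : Set ℂ), DifferentiableOn ℂ Ec O ∧ (∀ t ∈ Ioc (0 : ℝ) θ.γ, closedBall (t : ℂ) ρ₀ ⊆ O) ∧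
        (∀ z ∈ O, ‖Ec z‖ ≤ B * Real.exp (-(κE * (domSys (F.P K) M (k + 1)).dj X))) ∧
        (∀ t ∈ Ioc (0 : ℝ) θ.γ, Ec t = ((S K) k).E (Function.update g i t) φ X))
    (Ec : ℕ → ℕ → Type*) [∀ K k, NormedAddCommGroup (Ec K k)] [∀ K k, NormedSpace ℂ (Ec K k)]
    (ι : letI := θ.instVβ₁; letI := θ.instVβ₂
      (K k : ℕ) → (domSys (F.P K) M (k + 1)).Dom → ((Fin (F.P K).d → Site (F.P K) (k + 1) → θ.Vβ) →L[ℝ] Ec K k))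
    (Φ : (K k : ℕ) → (domSys (F.P K) M (k + 1)).Dom → Ec K k → CPair (F.P K) 𝔸)
    (U : (K k : ℕ) → (domSys (F.P K) M (k + 1)).Dom → Set (Ec K k)) (hU : ∀ K k X, IsOpen (U K k X)) (hrU : ∀ K k X, ball (0 : Ec K k) r ⊆ U K k X)
    (hEhol : ∀ g ∈ Window θ.γ, ∀ (K k : ℕ) (X : (domSys (F.P K) M (k + 1)).Dom),
      DifferentiableOn ℂ (fun z => ((S K) k).E (histPrefix g k) (Φ K k X z) X) (U K k X))
    (hΦemb : letI := θ.instVβ₁; letI := θ.instVβ₂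
      ∀ (K k : ℕ) (X : (domSys (F.P K) M (k + 1)).Dom) (Bf : Fin (F.P K).d → Site (F.P K) (k + 1) → θ.Vβ),
        Φ K k X (ι K k X Bf) = emb K k (fun l t => NormedSpace.exp (θ.ρ8 (Bf l t))))
    (hΦsp : ∀ (K k : ℕ) (X : (domSys (F.P K) M (k + 1)).Dom), ∀ z ∈ ball (0 : Ec K k) r, Φ K k X z ∈ sp K k X)
    (w : (K k : ℕ) → (domSys (F.P K) M (k + 1)).Dom → Site (F.P K) (k + 1) → ℝ) (hw₀ : ∀ K k X t, 0 ≤ w K k X t)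
    (hw : letI := θ.instVβ₁; letI := θ.instVβ₂; letI := θ.instιβ
      ∀ (K k : ℕ) (X : (domSys (F.P K) M (k + 1)).Dom) (l : Fin (F.P K).d) (t : Site (F.P K) (k + 1)) (c : θ.ιβ),
        ‖ι K k X (Pi.single l (Pi.single t (θ.bV c)))‖ ≤ w K k X t)
    (htail : ∀ (K k : ℕ) (X : (domSys (F.P K) M (k + 1)).Dom) (t : Site (F.P K) (k + 1)),
      let e : Site (F.P K) (k + 1) → TPt 4 (domCount (F.P K) M (k + 1) * M) := fun x i => (ZMod.cast (x i) : ZMod (domCount (F.P K) M (k + 1) * M))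
      w K k X t ≤ B₃ * Real.exp (-δ₀ * distCT (domCount (F.P K) M (k + 1)) M (e t) (nearT (M := M) (e t) X))) :
    DecayBound ((objectsOfRecord₁₃ F N θ ℓ).EA 0) (Window θ.γ)
      ((16 * B * B₃ ^ 2 / r ^ 2) * Real.exp (delta1 δ₀ κ ((M : ℝ) * 4) * ((M : ℝ) * 4) * 3) * K₀ (4 * 2 ^ 4) (2 * 4) * K₁ 4 (δ₀ / 2))
      (delta1 δ₀ κ ((M : ℝ) * 4)) := by
  letI := θ.instVβ₁; letI := θ.instVβ₂; letI := θ.instιβ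
  have hbd : ∀ g ∈ Window θ.γ, ∀ (K k : ℕ) (X : (domSys (F.P K) M (k + 1)).Dom), ∀ φ ∈ sp K k X,
      ‖((S K) k).E (histPrefix g k) φ X‖ ≤ B * Real.exp (-(κE * (domSys (F.P K) M (k + 1)).dj X)) :=
    fun g hg K k X φ hφ => outputBound_of_coordHolo F S sp hρ₀ hL K k (histPrefix g k) (fun i => hg i) X φ hφ
  have hUn := windowedDecayUniform_localizedSum_of_outputBound F m' M hM S emb θ.ρ8 θ.bV sp hκ₀ hδ₀ hB₃ hr hB hκE hbd Ec ι Φ U hU hrU hEhol hΦemb hΦsp w hw₀ hw htail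
  have hRec := (windowedDecayUniformOfRecord₁₃_iff_of_localizes F N θ S emb hloc _ _).2 hUn
  exact decayBound_EA_of_windowedDecayUniform F _ θ.ρ8 θ.bV hlim hRec


end Record

end YMDAG.N22.UniformDecay

end
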